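import Literature.NumberTheory.EllipticCurves.IwasawaTwistModP
import Literature.NumberTheory.GaloisRepresentations.CyclicIndexEulerChar
import Literature.NumberTheory.GaloisRepresentations.AbsGaloisGroupCompact
import Literature.NumberTheory.GaloisRepresentations.ContinuousCorestriction
import HarnessLib

/-!
# Shapiro's lemma for the Iwasawa twists: `𝒯_{p^n} = M ⊗ 𝔽_p[T]/(T^{p^n})(χ_κ)` IS the induced module
# `M_{Γ_K}^{Gal(K̄/K_n)}(M)`, hence `H^q(K, 𝒯_{p^n}) ≃ H^q(K_n, M)` (definitions + proofs; no named fact)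

Topic `NumberTheory/EllipticCurves` (sequel of `IwasawaTwistModP`, `IwasawaTwistModPTower`); namespace
`Literature.NumberTheory.EllipticCurves.ZpExtension`.  Cell `bsd-smallim` (rung K6 of `BirchSwinnertonDyer`,
class X9, crux `MuTransferX9` = item 19276, registered skeleton v4 / stub `stub_coreX9`), seat
`bsd-smallim-k6-ty` (typer), CORE-PLAN (k6-c2) **S2.1 [MISSING-VOCAB]**: "Shapiro
`H¹(ℚ, 𝒯_{p^n}) ≅ H¹(ℚ_n, E[p])` … what is missing is `coind_{Gal(ℚ̄/ℚ_n)}^{Γ_ℚ} E[p] ≅ 𝒯_{p^n}`".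
DEFINITIONS WITH BODIES AND THEOREMS ONLY — nothing is asserted (D-0026).

Let `K` be a field, `κ : ZpExtension K p` (`κ : Γ_K ↠ ℤ_p`, `Γ_n := Gal(K̄/K_n) = κ.layerSubgroup n =
κ⁻¹(p^n ℤ_p)`, an open normal subgroup of index `p^n`), `ρ : DiscreteGaloisModule K M`.

* `layerIndex κ n g = κ(g) mod p^n ∈ ℤ/p^n` (additive; `layerIndex_mul`, `layerIndex_eq_zero_iff`:
  kernel `= Γ_n`, `layerIndex_surjective`, `isOpen_setOf_layerIndex_eq`).
* **The group-ring model** `κ.twistGroupRing ρ n : DiscreteGaloisModule K (ZMod (p^n) → M)` —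
  `M ⊗_ℤ ℤ[Gal(K_n/K)]` with the DIAGONAL action `(g·y)(c) = ρ(g) (y (c − κ̄(g)))` (the coordinate
  `c ∈ ℤ/p^n` is the coset `γ̄^c`; `g` multiplies cosets by `ḡ = γ̄^{κ̄(g)}`), for ANY discrete `M` (no
  `p·M = 0` needed).  This is Serre's induced module: **`twistGroupRingEquivCoind`** is an explicit
  additive bijection onto the carrier of the tree's `coindRep (ρ.restrict (subgroupIncl Γ_n))`
  (`M_{Γ_K}^{Γ_n}(M) = {a : Γ_K → M continuous | a(s x) = ρ(s) a(x)}`, `CoinducedModule.lean`),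
  `y ↦ (g ↦ ρ(g) (y (−κ̄ g)))`, and it is `Γ_K`-equivariant (`twistGroupRingEquivCoind_smul`); packaged
  as an isomorphism of topological representations `twistGroupRingIsoCoind`
  ("`M_G^S(Res A) ≅ A ⊗ ℤ[G/S]`", Serre I §2.5 / Neukirch–Schmidt–Wingberg (1.6.4) for `S ⊴ G` of
  finite index and `A` a `G`-module).
* **Shapiro** `twistGroupRingCohomologyEquiv κ ρ n q :
  galoisCohomology (κ.twistGroupRing ρ n) (q+1) ≃ continuousCohomology (q+1) (ρ.restrict (subgroupIncl Γ_n)).toTopRep`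
  — the composite of the iso above with the tree's PROVED Shapiro bijection `shapiroEquiv`
  (`CyclicIndexEulerChar.lean`, Serre I §2.5 Prop. 10); the target is `H^{q+1}(Γ_n, M) = H^{q+1}(K_n, M)`
  in the currency `continuousCohomology _ (subgroupRep ρ.toTopRep Γ_n)` of `ContinuousCorestriction.lean`
  (= `H1 ρ Γ_n` of `EulerSystem.lean` in degree one), definitionally.
* **The `T`-basis**: for `M` killed by `p`, `𝒯_{p^n} := κ.twistModP ρ hM (p^n)` (file `IwasawaTwistModP`:
  coordinates = coefficients of `1, T, …, T^{p^n−1}`, `T = γ − 1`) is identified with the group-ring model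
  by the binomial change of basis `(1+T)^j = Σ_i C(j,i) T^i`:
  `toTBasis y = Σ_j (1+S)^j (y_j · T^0)` (`twistGroupRingToModP`, `Γ_K`-equivariant:
  `twistGroupRingToModP_smul`; uses `(1+S)^{p^n} = 1`, i.e. `p·M = 0`), bijective
  (`twistGroupRingToModP_bijective`: a unitriangular integer matrix), whence the isomorphism of
  topological representations `twistModPIsoGroupRing` and **Shapiro for `𝒯_{p^n}`**:
  `twistModPCohomologyEquiv κ ρ hM n q : galoisCohomology (κ.twistModP ρ hM (p^n)) (q+1) ≃ H^{q+1}(Γ_n, M)`.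

What this file does NOT do (next files / prover): the effect on `T` (`(1+T)·` ↔ the tree's
`coindTwist γ⁻¹` ↔ `conj_γ` on `H^q(Γ_n, M)`), on truncation/corestriction, and on localisation at
places (the local Shapiro `H¹(K_v, 𝒯_{p^n}) ≅ ⊕_{w ∣ v} H¹(K_{n,w}, M)`).

References: J.-P. Serre, *Galois Cohomology* (1997), I §2.5 (induced modules, Prop. 10)
[SerreGaloisCohomology1997]; J. Neukirch, A. Schmidt, K. Wingberg, *Cohomology of Number Fields*
(2008), (1.6.4) [NeukirchSchmidtWingberg2008]; B. Mazur, K. Rubin, *Kolyvagin systems*, Mem. AMS 799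
(2004) §5.3 (`T ⊗ Λ/(𝔪^k)`) [MazurRubin2004]; L. Washington, *Introduction to Cyclotomic Fields*,
§13.1–13.2 (`Λ = ℤ_p⟦T⟧`, `T = γ − 1`, `ℤ_p[Γ_n] = Λ/((1+T)^{p^n} − 1)`) [Washington1997];
HOME/koly/MU-TRANSFER-PROOF.md §0; HOME plan/k6/lines/MuTransferX9_CORE-PLAN_k6c2.md S2.1.
-/

noncomputable section

open scoped Topology ContRepresentation
open Field Filter CategoryTheory

universe u

namespace Literature.NumberTheory.EllipticCurves

open Literature.NumberTheory.GaloisRepresentations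

namespace ZpExtension

variable {K : Type u} [Field K] {p : ℕ} [Fact p.Prime] (κ : ZpExtension K p)

/-! ## The index `κ̄_n : Γ_K → ℤ/p^n` of an element modulo the `n`-th layer -/

/-- `κ̄_n(g) := κ(g) mod p^n ∈ ℤ/p^n` (additive notation): the image of `g` in
`Γ_K/Γ_n = Gal(K_n/K) ≅ ℤ/p^n`, `Γ_n = κ.layerSubgroup n`; `γ̄ ↦ 1` for a topological generator `γ`.
Ref: Washington, *Introduction to Cyclotomic Fields*, §13.1. [cite: Washington1997, §13.1–§13.2] -/
def layerIndex (n : ℕ) (g : absoluteGaloisGroup K) : ZMod (p ^ n) :=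
  PadicInt.toZModPow n (κ g).toAdd

/-- `κ̄_n(gh) = κ̄_n(g) + κ̄_n(h)`. [cite: Washington1997, §13.1–§13.2] -/
@[simp] theorem layerIndex_mul (n : ℕ) (g h : absoluteGaloisGroup K) :
    κ.layerIndex n (g * h) = κ.layerIndex n g + κ.layerIndex n h := by
  simp [layerIndex, map_mul, toAdd_mul]

/-- `κ̄_n(1) = 0`. [cite: Washington1997, §13.1–§13.2] -/
@[simp] theorem layerIndex_one (n : ℕ) : κ.layerIndex n 1 = 0 := by
  simp [layerIndex]

/-- `κ̄_n(g⁻¹) = −κ̄_n(g)`. [cite: Washington1997, §13.1–§13.2] -/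
@[simp] theorem layerIndex_inv (n : ℕ) (g : absoluteGaloisGroup K) :
    κ.layerIndex n g⁻¹ = -κ.layerIndex n g := by
  rw [eq_neg_iff_add_eq_zero, ← layerIndex_mul, inv_mul_cancel, layerIndex_one]

/-- `κ̄_n(g) = 0 ↔ g ∈ Γ_n = κ.layerSubgroup n` (`PadicInt.ker_toZModPow`).
[cite: Washington1997, §13.1–§13.2] -/
theorem layerIndex_eq_zero_iff (n : ℕ) (g : absoluteGaloisGroup K) :
    κ.layerIndex n g = 0 ↔ g ∈ κ.layerSubgroup n := by
  rw [mem_layerSubgroup, layerIndex, ← RingHom.mem_ker, PadicInt.ker_toZModPow,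
    Ideal.mem_span_singleton]

/-- `κ̄_n(g) = κ̄_n(h) ↔ g h⁻¹ ∈ Γ_n`. [cite: Washington1997, §13.1–§13.2] -/
theorem layerIndex_eq_iff (n : ℕ) (g h : absoluteGaloisGroup K) :
    κ.layerIndex n g = κ.layerIndex n h ↔ g * h⁻¹ ∈ κ.layerSubgroup n := by
  rw [← layerIndex_eq_zero_iff, layerIndex_mul, layerIndex_inv, add_neg_eq_zero]

/-- `κ̄_n` is onto `ℤ/p^n` (`κ` is onto `ℤ_p`). [cite: Washington1997, §13.1–§13.2] -/
theorem layerIndex_surjective (n : ℕ) : Function.Surjective (κ.layerIndex n) := by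
  intro c
  obtain ⟨x, hx⟩ := ZMod.intCast_surjective c
  obtain ⟨g, hg⟩ := κ.surjective (Multiplicative.ofAdd (x : ℤ_[p]))
  refine ⟨g, ?_⟩
  rw [layerIndex, show κ g = Multiplicative.ofAdd (x : ℤ_[p]) from hg, toAdd_ofAdd, map_intCast, hx]

/-- The fibres `{g | κ̄_n(g) = c}` are open (cosets of the open subgroup `Γ_n`).
[cite: Washington1997, §13.1–§13.2] -/
theorem isOpen_setOf_layerIndex_eq (n : ℕ) (c : ZMod (p ^ n)) :
    IsOpen {g : absoluteGaloisGroup K | κ.layerIndex n g = c} :=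
  (isOpen_discrete {c}).preimage
    ((PadicInt.continuous_toZModPow p n).comp (continuous_toAdd.comp (map_continuous κ)))

/-- The twist exponent of `IwasawaTwistModP` reduces to `κ̄_n`: `twistExponent J g ≡ κ̄_n(g)` in `ℤ/p^n`
for `n ≤ J` (`ℤ_p → ℤ/p^J → ℤ/p^n`). [cite: Washington1997, §13.1–§13.2] -/
theorem natCast_twistExponent (n J : ℕ) (h : n ≤ J) (g : absoluteGaloisGroup K) :
    ((κ.twistExponent J g : ℕ) : ZMod (p ^ n)) = κ.layerIndex n g := by
  haveI : NeZero (p ^ J) := ⟨pow_ne_zero _ (Fact.out : p.Prime).ne_zero⟩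
  have key := congrArg (fun f : ℤ_[p] →+* ZMod (p ^ n) => f (κ g).toAdd)
    (PadicInt.zmod_cast_comp_toZModPow n J h)
  simp only [RingHom.comp_apply, ZMod.castHom_apply, ZMod.cast_eq_val] at key
  exact key

/-! ## The group-ring model `M ⊗ ℤ[Γ_K/Γ_n]` with diagonal action -/

variable {M : Type u} [AddCommGroup M] [TopologicalSpace M] [DiscreteTopology M]
  (ρ : DiscreteGaloisModule K M) (n : ℕ)

/-- The representation of `Γ_K` on `ℤ/p^n → M` (`= M ⊗ ℤ[Γ_K/Γ_n]`, coordinate `c` = coefficient of the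
coset `γ̄^c`): `(g·y)(c) = ρ(g)(y(c − κ̄_n g))` — `g` acts diagonally, on `M` through `ρ` and on the cosets
by translation by `ḡ`.  Ref: Serre, *Galois Cohomology* I §2.5 ("`A ⊗ ℤ[G/H]`");
Mazur–Rubin, Mem. AMS 799 §5.3 (`T ⊗ Λ`). [cite: SerreGaloisCohomology1997, I §2.5] -/
def twistGroupRingRepresentation : Representation ℤ (absoluteGaloisGroup K) (ZMod (p ^ n) → M) where
  toFun g :=
    { toFun := fun y c => ρ g (y (c - κ.layerIndex n g))
      map_add' := fun y y' => by
        funext c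
        simp
      map_smul' := fun a y => by
        funext c
        simp }
  map_one' := by
    refine LinearMap.ext fun y => funext fun c => ?_
    simp
  map_mul' g h := by
    refine LinearMap.ext fun y => funext fun c => ?_
    simp only [layerIndex_mul, map_mul, LinearMap.coe_mk, AddHom.coe_mk, Module.End.mul_apply]
    congr 2
    abel

/-- Unfolding lemma for `twistGroupRingRepresentation`. [cite: SerreGaloisCohomology1997, I §2.5] -/
@[simp] theorem twistGroupRingRepresentation_apply (g : absoluteGaloisGroup K) (y : ZMod (p ^ n) → M)
    (c : ZMod (p ^ n)) :
    κ.twistGroupRingRepresentation ρ n g y c = ρ g (y (c - κ.layerIndex n g)) := rfl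

/-- **`M ⊗ ℤ[Gal(K_n/K)]` with the diagonal `Γ_K`-action, as a DISCRETE Galois module** (the induced
module `Ind_{K_n}^{K} M` in group-ring coordinates).  Continuity: the stabiliser of `y` contains
`(⋂_c Stab_ρ(y c)) ∩ Γ_n`, a neighbourhood of `1`. [cite: SerreGaloisCohomology1997, I §2.5] -/
def twistGroupRing : DiscreteGaloisModule K (ZMod (p ^ n) → M) :=
  ContinuousRep.ofStabilizerMemNhdsOne (κ.twistGroupRingRepresentation ρ n) fun y => by
    have h1 : (κ.layerSubgroup n : Set (absoluteGaloisGroup K)) ∈ 𝓝 (1 : absoluteGaloisGroup K) :=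
      (κ.isOpen_layerSubgroup n).mem_nhds (one_mem _)
    have h2 : (⋂ c : ZMod (p ^ n), {σ : absoluteGaloisGroup K | ρ σ (y c) = y c}) ∈
        𝓝 (1 : absoluteGaloisGroup K) :=
      (Filter.iInter_mem).2 fun c => ρ.setOf_apply_eq_mem_nhds_one (y c)
    filter_upwards [h1, h2] with σ hσ1 hσ2
    simp only [Set.mem_iInter, Set.mem_setOf_eq] at hσ2
    funext c
    rw [twistGroupRingRepresentation_apply, (κ.layerIndex_eq_zero_iff n σ).2 hσ1, sub_zero, hσ2]

/-- Unfolding lemma: `(g·y)(c) = ρ(g)(y(c − κ̄_n g))`. [cite: SerreGaloisCohomology1997, I §2.5] -/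
@[simp] theorem twistGroupRing_apply (g : absoluteGaloisGroup K) (y : ZMod (p ^ n) → M) (c : ZMod (p ^ n)) :
    κ.twistGroupRing ρ n g y c = ρ g (y (c - κ.layerIndex n g)) := rfl

/-! ## The identification with Serre's induced module `M_{Γ_K}^{Γ_n}(M)` -/

/-- The restriction of `ρ` to `Γ_n = κ.layerSubgroup n` as a continuous representation of the subgroup
(the `S`-module whose induced module `coindRep` is formed). [cite: SerreGaloisCohomology1997, I §2.5] -/
abbrev restrictLayer : ContinuousRep (κ.layerSubgroup n) ℤ M :=
  ContinuousRep.restrict ρ (subgroupIncl (κ.layerSubgroup n))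

/-- The function `g ↦ ρ(g)(y(−κ̄_n g))` attached to `y : ℤ/p^n → M`; it is locally constant.
[cite: SerreGaloisCohomology1997, I §2.5] -/
def toCoindFun (y : ZMod (p ^ n) → M) : C(absoluteGaloisGroup K, M) where
  toFun g := ρ g (y (-κ.layerIndex n g))
  continuous_toFun := by
    refine (IsLocallyConstant.iff_exists_open _).2 (fun g₀ => ?_) |>.continuous
    refine ⟨{g | κ.layerIndex n g = κ.layerIndex n g₀} ∩
        {g | ρ g (y (-κ.layerIndex n g₀)) = ρ g₀ (y (-κ.layerIndex n g₀))},
      (κ.isOpen_setOf_layerIndex_eq n _).inter ?_, ⟨rfl, rfl⟩, ?_⟩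
    · -- `g ↦ ρ g m` is continuous into the discrete `M`
      exact (isOpen_discrete ({ρ g₀ (y (-κ.layerIndex n g₀))} : Set M)).preimage
        (ρ.continuous_apply_left (y (-κ.layerIndex n g₀)))
    · rintro g ⟨hg1, hg2⟩
      simp only [Set.mem_setOf_eq] at hg1 hg2 ⊢
      rw [hg1, hg2]

/-- Unfolding lemma for `toCoindFun`. [cite: SerreGaloisCohomology1997, I §2.5] -/
@[simp] theorem toCoindFun_apply (y : ZMod (p ^ n) → M) (g : absoluteGaloisGroup K) :
    κ.toCoindFun ρ n y g = ρ g (y (-κ.layerIndex n g)) := rfl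

/-- `g ↦ ρ(g)(y(−κ̄_n g))` lies in the induced module: `a(s g) = ρ(s) a(g)` for `s ∈ Γ_n`
(`κ̄_n(s) = 0`). [cite: SerreGaloisCohomology1997, I §2.5] -/
theorem toCoindFun_mem (y : ZMod (p ^ n) → M) :
    κ.toCoindFun ρ n y ∈ coindModule (κ.restrictLayer ρ n) := by
  rw [mem_coind_iff]
  intro s g
  rw [toCoindFun_apply, toCoindFun_apply, layerIndex_mul,
    (κ.layerIndex_eq_zero_iff n s).2 s.2, zero_add, map_mul, Module.End.mul_apply]
  rfl

/-- A lift `g_c ∈ Γ_K` of `−c`: `κ̄_n(g_c) = −c` (choice, from `layerIndex_surjective`).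
[cite: SerreGaloisCohomology1997, I §2.5] -/
def liftNeg (c : ZMod (p ^ n)) : absoluteGaloisGroup K :=
  (κ.layerIndex_surjective n (-c)).choose

/-- The defining property of the lift: `κ̄_n(g_c) = −c`. [cite: Washington1997, §13.1–§13.2] -/
@[simp] theorem layerIndex_liftNeg (c : ZMod (p ^ n)) : κ.layerIndex n (κ.liftNeg n c) = -c :=
  (κ.layerIndex_surjective n (-c)).choose_spec

/-- The inverse construction: `F ↦ (c ↦ ρ(g_c)⁻¹ F(g_c))` with `κ̄_n(g_c) = −c` (independent of the
lift by the defining relation `F(s g) = ρ(s) F(g)`). [cite: SerreGaloisCohomology1997, I §2.5] -/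
def ofCoindFun (F : coindModule (κ.restrictLayer ρ n)) (c : ZMod (p ^ n)) : M :=
  ρ (κ.liftNeg n c)⁻¹ ((F : C(absoluteGaloisGroup K, M)) (κ.liftNeg n c))

/-- The value of an element of the induced module at `g` is determined by its value at any `g'` in the
same `Γ_n`-coset: `F(g) = ρ(g g'⁻¹) F(g')`. [cite: SerreGaloisCohomology1997, I §2.5] -/
theorem coind_apply_eq_of_layerIndex_eq (F : coindModule (κ.restrictLayer ρ n))
    {g g' : absoluteGaloisGroup K} (h : κ.layerIndex n g = κ.layerIndex n g') :
    (F : C(absoluteGaloisGroup K, M)) g = ρ (g * g'⁻¹) ((F : C(absoluteGaloisGroup K, M)) g') := by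
  have hs : g * g'⁻¹ ∈ κ.layerSubgroup n := (κ.layerIndex_eq_iff n g g').1 h
  have key := (mem_coind_iff (κ.restrictLayer ρ n) _).1 F.2 ⟨g * g'⁻¹, hs⟩ g'
  rw [show ((⟨g * g'⁻¹, hs⟩ : κ.layerSubgroup n) : absoluteGaloisGroup K) * g' = g by
    simp [mul_assoc]] at key
  exact key

/-- **`M ⊗ ℤ[Γ_K/Γ_n] ≃ M_{Γ_K}^{Γ_n}(M)`** as additive groups: `y ↦ (g ↦ ρ(g) y(−κ̄_n g))`, with inverse
`F ↦ (c ↦ ρ(g_c)⁻¹ F(g_c))`.  ("`M_G^S(Res A) ≅ A ⊗ ℤ[G/S]`".) [cite: SerreGaloisCohomology1997, I §2.5]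
[cite: NeukirchSchmidtWingberg2008, (1.6.4)] -/
def twistGroupRingEquivCoind : (ZMod (p ^ n) → M) ≃+ coindModule (κ.restrictLayer ρ n) where
  toFun y := ⟨κ.toCoindFun ρ n y, κ.toCoindFun_mem ρ n y⟩
  invFun := κ.ofCoindFun ρ n
  left_inv y := by
    funext c
    simp only [ofCoindFun, toCoindFun_apply, layerIndex_liftNeg, neg_neg]
    rw [← Module.End.mul_apply, ← map_mul, inv_mul_cancel, map_one, Module.End.one_apply]
  right_inv F := by
    refine Subtype.ext (ContinuousMap.ext fun g => ?_)
    simp only [toCoindFun_apply, ofCoindFun]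
    rw [← Module.End.mul_apply, ← map_mul,
      ← κ.coind_apply_eq_of_layerIndex_eq ρ n F (g := g) (g' := κ.liftNeg n (-κ.layerIndex n g))]
    rw [layerIndex_liftNeg, neg_neg]
  map_add' y y' := by
    refine Subtype.ext (ContinuousMap.ext fun g => ?_)
    simp

/-- Unfolding lemma for `twistGroupRingEquivCoind`: `Φ(y)(g) = ρ(g) y(−κ̄_n g)`.
[cite: SerreGaloisCohomology1997, I §2.5] -/
@[simp] theorem coe_twistGroupRingEquivCoind_apply (y : ZMod (p ^ n) → M) (g : absoluteGaloisGroup K) :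
    ((κ.twistGroupRingEquivCoind ρ n y : coindModule (κ.restrictLayer ρ n)) :
      C(absoluteGaloisGroup K, M)) g = ρ g (y (-κ.layerIndex n g)) := rfl

section Coind

/-! In this section `Γ_K` is assumed compact as an instance BINDER (it always is:
`absoluteGaloisGroup_compactSpace K`, an instance for `[CharZero K]`; consumers over other fields write
`haveI := absoluteGaloisGroup_compactSpace K`) — Serre's `coindRep` is stated for compact groups. -/

variable [CompactSpace (absoluteGaloisGroup K)]

/-- **The identification is `Γ_K`-equivariant**: `Φ(g·y) = g·Φ(y)` for Serre's action `(g a)(x) = a(x g)`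
on the induced module (`coindRep`). [cite: SerreGaloisCohomology1997, I §2.5] -/
theorem twistGroupRingEquivCoind_smul (g : absoluteGaloisGroup K) (y : ZMod (p ^ n) → M) :
    κ.twistGroupRingEquivCoind ρ n (κ.twistGroupRing ρ n g y) =
      coindRep (κ.restrictLayer ρ n) g (κ.twistGroupRingEquivCoind ρ n y) := by
  refine Subtype.ext (ContinuousMap.ext fun x => ?_)
  rw [coe_twistGroupRingEquivCoind_apply, coindRep_apply_apply, coe_twistGroupRingEquivCoind_apply,
    twistGroupRing_apply, layerIndex_mul, map_mul, Module.End.mul_apply, neg_add, sub_eq_add_neg]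

/-- **`M ⊗ ℤ[Γ_K/Γ_n] ≅ M_{Γ_K}^{Γ_n}(M)` as topological representations of `Γ_K`** (both discrete).
[cite: SerreGaloisCohomology1997, I §2.5] [cite: NeukirchSchmidtWingberg2008, (1.6.4)] -/
def twistGroupRingIsoCoind :
    (κ.twistGroupRing ρ n).toTopRep ≅ (coindRep (κ.restrictLayer ρ n)).toTopRep :=
  haveI : DiscreteTopology (coindModule (κ.restrictLayer ρ n)) := discreteTopology_coind _
  topRepIsoOfEquiv
    ({ (κ.twistGroupRingEquivCoind ρ n).toIntLinearEquiv with
        continuous_toFun := continuous_of_discreteTopology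
        continuous_invFun := continuous_of_discreteTopology } :
      (ZMod (p ^ n) → M) ≃L[ℤ] coindModule (κ.restrictLayer ρ n))
    fun g y => κ.twistGroupRingEquivCoind_smul ρ n g y

/-- **Shapiro's lemma for `M ⊗ ℤ[Γ_K/Γ_n]`: `H^{q+1}(K, M ⊗ ℤ[Gal(K_n/K)]) ≃ H^{q+1}(K_n, M)`**, the
composite of `twistGroupRingIsoCoind` with the tree's Shapiro bijection `shapiroEquiv`
(`H^{q+1}(G, M_G^S(M)) ≃ H^{q+1}(S, M)`, Serre I §2.5 Prop. 10, PROVED in `CyclicIndexEulerChar.lean`).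
The target is `H^{q+1}(Γ_n, M)` in the currency `continuousCohomology _ (subgroupRep ρ.toTopRep Γ_n)`.
[cite: SerreGaloisCohomology1997, I §2.5 Prop. 10] [cite: NeukirchSchmidtWingberg2008, (1.6.4)] -/
def twistGroupRingCohomologyEquiv (q : ℕ) :
    galoisCohomology (κ.twistGroupRing ρ n) (q + 1) ≃
      continuousCohomology (q + 1) (κ.restrictLayer ρ n).toTopRep :=
  haveI : IsClosed ((κ.layerSubgroup n : Subgroup (absoluteGaloisGroup K)) : Set (absoluteGaloisGroup K)) :=
    (κ.layerSubgroup n).isClosed_of_isOpen (κ.isOpen_layerSubgroup n)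
  (continuousCohomologyEquivOfIso (κ.twistGroupRingIsoCoind ρ n) (q + 1)).trans
    (shapiroEquiv (κ.layerSubgroup n) ρ q)

/-- The target of the Shapiro bijection is the tree's `H^{q+1}(Γ_n, M)` of `ContinuousCorestriction.lean`
(`subgroupRep`), definitionally. [folklore] -/
example (q : ℕ) :
    continuousCohomology (q + 1) (κ.restrictLayer ρ n).toTopRep =
      continuousCohomology (q + 1) (subgroupRep ρ.toTopRep (κ.layerSubgroup n)) := rfl

end Coind

/-! ## The `T`-basis: `𝒯_{p^n} = κ.twistModP ρ hM (p^n)` versus the group-ring model -/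

end ZpExtension

section Binomial

variable {M : Type*} [AddCommGroup M]

/-- Coordinates of `(1+S)^a (m·T^0)`: `((1+S)^a δ_0 m)_i = C(a, i)·m` — the binomial expansion
`(1+T)^a = Σ_i C(a,i) T^i` in `M ⊗ ℤ[T]/(T^J)`. [cite: Washington1997, §13.1–§13.2] -/
theorem unipotentPow_single_zero_apply {J : ℕ} (hJ : 0 < J) (a : ℕ) (m : M) (i : Fin J) :
    unipotentPow M J a (Pi.single (⟨0, hJ⟩ : Fin J) m) i = (a.choose i) • m := by
  classical
  induction a generalizing i with
  | zero =>
    rw [unipotentPow_zero, Module.End.one_apply, Pi.single_apply]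
    by_cases h : (i : ℕ) = 0
    · rw [if_pos (Fin.ext h), h, Nat.choose_zero_right, one_smul]
    · rw [if_neg (fun h' => h (congrArg Fin.val h')), show (0 : ℕ).choose i = 0 from
        Nat.choose_eq_zero_of_lt (Nat.pos_of_ne_zero h), zero_smul]
  | succ a ih =>
    rw [ZpExtension.unipotentPow_succ_apply, Pi.add_apply, ih, shiftEnd_apply]
    by_cases h : (i : ℕ) = 0
    · rw [dif_pos h, add_zero, h, Nat.choose_zero_right, Nat.choose_zero_right]
    · rw [dif_neg h, ih]
      obtain ⟨k, hk⟩ := Nat.exists_eq_succ_of_ne_zero h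
      simp only [hk, Nat.choose_succ_succ', add_smul, Nat.succ_sub_one, add_comm]

end Binomial

namespace ZpExtension

section TBasis

variable {p : ℕ} [Fact p.Prime] {M : Type*} [AddCommGroup M] (n : ℕ)

/-- `0 < p^n` (plumbing for the index `0 : Fin (p^n)`). [folklore] -/
private theorem pow_pos_layer : 0 < p ^ n := pow_pos (Fact.out : p.Prime).pos n

/-- On a module killed by `p`, `(1+S)^a` on `Fin (p^n) → M` depends only on `a mod p^n`
(`(1+S)^{p^n} = 1`, `unipotentPow_mod`). [cite: Washington1997, §13.1–§13.2] -/
theorem unipotentPow_eq_of_natCast_eq (hM : ∀ x : M, p • x = 0) {a b : ℕ}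
    (h : (a : ZMod (p ^ n)) = b) : unipotentPow M (p ^ n) a = unipotentPow M (p ^ n) b := by
  rw [← unipotentPow_mod hM (le_refl (p ^ n)) a, ← unipotentPow_mod hM (le_refl (p ^ n)) b,
    (ZMod.natCast_eq_natCast_iff' a b (p ^ n)).1 h]

/-- **The binomial change of basis `M ⊗ ℤ[Γ_K/Γ_n] → 𝒯_{p^n}`** (an additive map):
`y ↦ Σ_j (1+S)^j (y_j · T^0)` — the coset `γ̄^j` is sent to `(1+T)^j = Σ_i C(j,i) T^i` (`T = γ − 1`).
[cite: Washington1997, §13.1–§13.2] -/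
def twistGroupRingToModP : (ZMod (p ^ n) → M) →+ (Fin (p ^ n) → M) where
  toFun y := ∑ j : ZMod (p ^ n),
    unipotentPow M (p ^ n) j.val (Pi.single (⟨0, pow_pos_layer n⟩ : Fin (p ^ n)) (y j))
  map_zero' := by simp
  map_add' y y' := by
    simp only [Pi.add_apply, Pi.single_add, map_add, Finset.sum_add_distrib]

/-- Unfolding lemma for `twistGroupRingToModP`. [cite: Washington1997, §13.1–§13.2] -/
theorem twistGroupRingToModP_def (y : ZMod (p ^ n) → M) :
    twistGroupRingToModP (p := p) (M := M) n y = ∑ j : ZMod (p ^ n),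
      unipotentPow M (p ^ n) j.val (Pi.single (⟨0, pow_pos_layer n⟩ : Fin (p ^ n)) (y j)) := rfl

/-- Coordinates: `(toT y)_i = Σ_j C(j, i) · y_j`. [cite: Washington1997, §13.1–§13.2] -/
theorem twistGroupRingToModP_apply (y : ZMod (p ^ n) → M) (i : Fin (p ^ n)) :
    twistGroupRingToModP (p := p) n y i = ∑ j : ZMod (p ^ n), (j.val.choose i) • y j := by
  rw [twistGroupRingToModP_def, Finset.sum_apply]
  exact Finset.sum_congr rfl fun j _ => unipotentPow_single_zero_apply _ _ _ _

/-- `toT` on a vector supported at one coset: `toT(δ_j m)_i = C(j, i)·m`.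
[cite: Washington1997, §13.1–§13.2] -/
theorem twistGroupRingToModP_single_apply (j : ZMod (p ^ n)) (m : M) (i : Fin (p ^ n)) :
    twistGroupRingToModP (p := p) n (Pi.single j m) i = (j.val.choose i) • m := by
  classical
  rw [twistGroupRingToModP_apply, Finset.sum_eq_single j]
  · rw [Pi.single_eq_same]
  · intro j' _ hj'
    rw [Pi.single_eq_of_ne hj', smul_zero]
  · intro h
    exact absurd (Finset.mem_univ j) h

/-- **`toT` is injective** (the matrix `(C(j,i))` is unitriangular: read off `y_{N−1}, y_{N−2}, …` from the
top coordinate down). [cite: Washington1997, §13.1–§13.2] -/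
theorem twistGroupRingToModP_injective :
    Function.Injective (twistGroupRingToModP (p := p) (M := M) n) := by
  classical
  haveI : NeZero (p ^ n) := ⟨(pow_pos_layer (p := p) n).ne'⟩
  refine (injective_iff_map_eq_zero _).2 fun z hz => ?_
  -- downward induction: all `z_j` with `j.val ≥ p^n − t` vanish
  have key : ∀ t : ℕ, ∀ j : ZMod (p ^ n), p ^ n - t ≤ j.val → z j = 0 := by
    intro t
    induction t with
    | zero =>
      intro j hj
      exact absurd (ZMod.val_lt j) (not_lt.2 (by simpa using hj))
    | succ t ih =>
      intro j hj
      by_cases hjt : p ^ n - t ≤ j.val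
      · exact ih j hjt
      · have hjeq : j.val = p ^ n - (t + 1) := by omega
        have hi : p ^ n - (t + 1) < p ^ n := by
          have := ZMod.val_lt j
          omega
        have hcoord := congrFun hz ⟨p ^ n - (t + 1), hi⟩
        rw [twistGroupRingToModP_apply, Pi.zero_apply, Finset.sum_eq_single j] at hcoord
        · rw [hjeq, Nat.choose_self, one_smul] at hcoord
          exact hcoord
        · intro j' _ hj'
          by_cases hlt : j'.val < p ^ n - (t + 1)
          · rw [Nat.choose_eq_zero_of_lt hlt, zero_smul]
          · by_cases hgt : p ^ n - t ≤ j'.val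
            · rw [ih j' hgt, smul_zero]
            · exfalso
              apply hj'
              apply ZMod.val_injective (p ^ n)
              omega
        · intro hmem
          exact absurd (Finset.mem_univ j) hmem
  funext j
  exact key (p ^ n) j (by omega)

/-- **`toT` is surjective** (solve for `y` from the bottom coordinate up: `toT(δ_j m)` is supported on
the coordinates `≤ j`, with `m` in coordinate `j`). [cite: Washington1997, §13.1–§13.2] -/
theorem twistGroupRingToModP_surjective :
    Function.Surjective (twistGroupRingToModP (p := p) (M := M) n) := by
  classical
  haveI : NeZero (p ^ n) := ⟨(pow_pos_layer (p := p) n).ne'⟩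
  -- `R s`: every `x` supported on coordinates `< s` is in the range
  have key : ∀ s : ℕ, ∀ x : Fin (p ^ n) → M, (∀ i : Fin (p ^ n), s ≤ i.val → x i = 0) →
      ∃ y, twistGroupRingToModP (p := p) n y = x := by
    intro s
    induction s with
    | zero =>
      intro x hx
      refine ⟨0, ?_⟩
      rw [map_zero]
      funext i
      exact (hx i (Nat.zero_le _)).symm
    | succ s ih =>
      intro x hx
      by_cases hs : s < p ^ n
      · -- peel off the coordinate `s`
        have hsval : ((s : ZMod (p ^ n))).val = s := by
          rw [ZMod.val_natCast, Nat.mod_eq_of_lt hs]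
        have hx'supp : ∀ i : Fin (p ^ n), s ≤ i.val →
            (x - twistGroupRingToModP (p := p) n (Pi.single (s : ZMod (p ^ n)) (x ⟨s, hs⟩))) i = 0 := by
          intro i hi
          rw [Pi.sub_apply, twistGroupRingToModP_single_apply, hsval]
          rcases Nat.eq_or_lt_of_le hi with h | h
          · have : i = ⟨s, hs⟩ := Fin.ext h.symm
            rw [this, Nat.choose_self, one_smul, sub_self]
          · rw [Nat.choose_eq_zero_of_lt h, zero_smul, sub_zero]
            exact hx i h
        obtain ⟨y', hy'⟩ := ih _ hx'supp
        refine ⟨y' + Pi.single (s : ZMod (p ^ n)) (x ⟨s, hs⟩), ?_⟩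
        rw [map_add, hy', sub_add_cancel]
      · exact ih x fun i hi => absurd (lt_of_lt_of_le i.2 (le_trans (not_lt.1 hs) hi)) (lt_irrefl _)
  intro x
  exact key (p ^ n) x fun i hi => absurd (lt_of_lt_of_le i.2 hi) (lt_irrefl _)

/-- **`toT` is bijective.** [cite: Washington1997, §13.1–§13.2] -/
theorem twistGroupRingToModP_bijective :
    Function.Bijective (twistGroupRingToModP (p := p) (M := M) n) :=
  ⟨twistGroupRingToModP_injective n, twistGroupRingToModP_surjective n⟩

/-- Coordinatewise application of an additive map commutes with `toT` (the basis change has integer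
coefficients). [cite: Washington1997, §13.1–§13.2] -/
theorem map_twistGroupRingToModP (f : M →ₗ[ℤ] M) (y : ZMod (p ^ n) → M) :
    (fun i => f (twistGroupRingToModP (p := p) n y i)) =
      twistGroupRingToModP (p := p) n (fun c => f (y c)) := by
  funext i
  rw [twistGroupRingToModP_apply, twistGroupRingToModP_apply, map_sum]
  simp only [map_nsmul]

end TBasis

section TBasisEquivariant

variable {K : Type u} [Field K] {p : ℕ} [Fact p.Prime] (κ : ZpExtension K p)
  {M : Type u} [AddCommGroup M] [TopologicalSpace M] [DiscreteTopology M]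
  (ρ : DiscreteGaloisModule K M) (hM : ∀ x : M, p • x = 0) (n : ℕ)

/-- **`toT` is `Γ_K`-equivariant**: `toT(g·y) = g·toT(y)` for the diagonal action on `M ⊗ ℤ[Γ_K/Γ_n]` and
the action `(1+S)^{κ(g)} ∘ ρ(g)` on `𝒯_{p^n}` (`twistModP_apply`); the point is
`(1+T)·(1+T)^j = (1+T)^{j+1}` with `(1+T)^{p^n} = 1` mod `p`. [cite: Washington1997, §13.1–§13.2] -/
theorem twistGroupRingToModP_smul (g : absoluteGaloisGroup K) (y : ZMod (p ^ n) → M) :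
    twistGroupRingToModP (p := p) n (κ.twistGroupRing ρ n g y) =
      κ.twistModP ρ hM (p ^ n) g (twistGroupRingToModP (p := p) n y) := by
  classical
  haveI : NeZero (p ^ n) := ⟨(pow_pos_layer (p := p) n).ne'⟩
  rw [twistModP_apply, map_twistGroupRingToModP]
  -- both sides are sums over the cosets; reindex the left one by `j ↦ j − κ̄_n g`
  rw [twistGroupRingToModP_def, twistGroupRingToModP_def, map_sum]
  refine Fintype.sum_equiv (Equiv.subRight (κ.layerIndex n g)) _ _ fun j => ?_
  have hexp : unipotentPow M (p ^ n) j.val =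
      unipotentPow M (p ^ n) (κ.twistExponent (p ^ n) g + (j - κ.layerIndex n g).val) := by
    refine unipotentPow_eq_of_natCast_eq n hM ?_
    rw [Nat.cast_add, κ.natCast_twistExponent n (p ^ n) (Nat.lt_pow_self (Fact.out : p.Prime).one_lt).le,
      ZMod.natCast_zmod_val, ZMod.natCast_zmod_val, add_sub_cancel]
  rw [Equiv.subRight_apply, twistGroupRing_apply, ← Module.End.mul_apply, ← unipotentPow_add, hexp]

/-- **`M ⊗ ℤ[Γ_K/Γ_n] ≅ 𝒯_{p^n}` as topological representations of `Γ_K`** (both discrete), for `M` killed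
by `p`. [cite: Washington1997, §13.1–§13.2] [cite: SerreGaloisCohomology1997, I §2.5] -/
def twistGroupRingIsoModP :
    (κ.twistGroupRing ρ n).toTopRep ≅ (κ.twistModP ρ hM (p ^ n)).toTopRep :=
  topRepIsoOfEquiv
    ({ (AddEquiv.ofBijective (twistGroupRingToModP (p := p) (M := M) n)
          (twistGroupRingToModP_bijective n)).toIntLinearEquiv with
        continuous_toFun := continuous_of_discreteTopology
        continuous_invFun := continuous_of_discreteTopology } :
      (ZMod (p ^ n) → M) ≃L[ℤ] (Fin (p ^ n) → M))
    fun g y => κ.twistGroupRingToModP_smul ρ hM n g y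

variable [CompactSpace (absoluteGaloisGroup K)]

/-- **Shapiro's lemma for `𝒯_{p^n}`: `H^{q+1}(K, 𝒯_{p^n}) ≃ H^{q+1}(K_n, M)`** (`𝒯_{p^n} = M ⊗ 𝔽_p[T]/(T^{p^n})(χ_κ)
= κ.twistModP ρ hM (p^n)`, `M` killed by `p`; target `H^{q+1}(Γ_n, M) = continuousCohomology (q+1)
(subgroupRep ρ.toTopRep (κ.layerSubgroup n))`): the composite `𝒯_{p^n} ≅ M ⊗ ℤ[Γ_K/Γ_n] ≅ M_{Γ_K}^{Γ_n}(M)`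
followed by the tree's Shapiro bijection.  CORE-PLAN S2.1.
[cite: SerreGaloisCohomology1997, I §2.5 Prop. 10] [cite: NeukirchSchmidtWingberg2008, (1.6.4)] -/
def twistModPCohomologyEquiv (q : ℕ) :
    galoisCohomology (κ.twistModP ρ hM (p ^ n)) (q + 1) ≃
      continuousCohomology (q + 1) (κ.restrictLayer ρ n).toTopRep :=
  (continuousCohomologyEquivOfIso (κ.twistGroupRingIsoModP ρ hM n).symm (q + 1)).trans
    (κ.twistGroupRingCohomologyEquiv ρ n q)

/-- Degree one: `H¹(K, 𝒯_{p^n}) ≃ H¹(K_n, M) = H1 ρ (κ.layerSubgroup n)` (the `H1` of `EulerSystem.lean` /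
`IwasawaCohomology.lean` is `continuousCohomology 1 (subgroupRep _ _)`, the target up to `rfl`).
[cite: SerreGaloisCohomology1997, I §2.5 Prop. 10] -/
def twistModPH1Equiv :
    galoisCohomology (κ.twistModP ρ hM (p ^ n)) 1 ≃
      continuousCohomology 1 (subgroupRep ρ.toTopRep (κ.layerSubgroup n)) :=
  κ.twistModPCohomologyEquiv ρ hM n 0

end TBasisEquivariant

end ZpExtension

end Literature.NumberTheory.EllipticCurves
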